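import Summits.CriticalPhenomena.PercolationContinuityZ3.Theorems.Transplant.FKConnectivityAllQFKCrossNegAssoc
import HarnessLib

/-!
# The `q → 0⁺` boundary of vdBHK's Theorem 1.4 for `φ_{w,q}`: `FKCrossNegAssocPos → TwoClusterCrossNegAssocPos` (kernel arrow)

Support file (`--supports stmt-CriticalPhenomena-4575`), FK sub-lane `prim-bschramm-fk-1` (gen 15) of the post-continuity programme;
builds on p205010 (kernel theorem, internal audit signed; external expert review pending).  Proofs only (no definitions, no named
facts, no sorries); standard axioms.

THE TWO NODES (fk-1 g14).  `FKCrossNegAssocOn V q` (`…FKCrossNegAssoc.lean`): for `φ = φ_{w,q} = rcMeasureW w q ∅`, `D = {a ↮ c}` and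
monotone `F, G` of the open edge clusters, `φ(D)·∫_D F(C_a)G(C_c) dφ ≤ (∫_D F(C_a) dφ)(∫_D G(C_c) dφ)` — van den Berg–Häggström–Kahn's
Theorem 1.4 for the random-cluster measure; a THEOREM for `q ≥ 1` (`fkCrossNegAssocOn_of_one_le`, from the tree's vdBHK Thm. 2.1 for
`rcMeasureW`), a conjecture for `0 < q < 1` (`FKCrossNegAssocPos`).  `TwoClusterCrossNegAssocOn V` (`…TwoClusterCrossNegAssoc.lean`, the
MASTER node of the two-cluster corner): the same inequality for Bernoulli percolation `P_w` on `E = {a ↮ c} ∩ {k = 2}`.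
THIS FILE makes the docstring remark of `…FKCrossNegAssoc.lean` ("the `q → 0⁺` limit at fixed `w` is the level-two node") a kernel arrow:
**`twoClusterCrossNegAssocOn_of_forall_fkCrossNegAssocOn : (∀ q, 0 < q → q < 1 → FKCrossNegAssocOn V q) → TwoClusterCrossNegAssocOn V`**
and **`twoClusterCrossNegAssocPos_of_fkCrossNegAssocPos : FKCrossNegAssocPos → TwoClusterCrossNegAssocPos`**.  Proof: for an integrand `h`
and `D ⊆ {a ↮ c}` (which forces `k ≥ 2`, `two_le_clusterCount_of_not_reachable`),
`(∫_D h dφ_{w,q})·Z_{w,q} = Σ_ω weight_w(ω) q^{k(ω)} h(ω) 1_D(ω) = q²·M_h(q)` with the polynomial `M_h(q) = Σ_ω weight_w(ω) q^{k(ω)−2} h(ω) 1_D(ω)`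
(`setIntegral_mul_Z_eq_sq_mul`), `M_h(0) = ∫_{D ∩ {k=2}} h dP_w` (`levelMass_zero`); multiplying the FK inequality by `Z²`, dividing by `q⁴` and
letting `q → 0⁺` gives the level-two inequality (same route as g12's `twoCluster_fourPoint_of_forall_fourPointFK` for events).
So the whole `q < 1` column of the two-cluster corner is ONE statement: vdBHK Thm. 1.4 for `φ_{w,q}`, `0 < q < 1`, whose `q → 0⁺` boundary
(this file) is the master node, which in turn yields CA₂, FP2, EDOM, OSNC (`…TwoClusterCrossNegAssoc.lean`).
[cite: VandenbergHaggstromKahn2005, Thm. 1.4 (p. 7); Thm. 2.1 (p. 8)] [cite: Grimmett2006, §1.4 eq. (1.20) (p. 15); §1.2 eq. (1.1) (p. 4); §3.9 (pp. 63–65)]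
-/

noncomputable section

namespace Summit.CriticalPhenomena.PercolationContinuityZ3.Theorems

namespace FK

open MeasureTheory Set Filter Topology Literature.Probability.LatticeModels Literature.Probability.Percolation
open Literature.Probability.Percolation.BHK2006 (weight weight_nonneg rcMass integral_rcMeasureW_eq_sum setIntegral_rcMeasureW_eq_sum
  integral_prodBernoulli_eq_sum)
open Literature.Probability.Percolation.DecisionTree (ind ind_of_mem ind_of_not_mem ind_nonneg)
open scoped Classical

variable {V : Type*} [Fintype V]

/-! ### The level mass of an integrand and the `q²` factorisation -/

/-- The random-cluster weight is the product weight times `q^k`. [cite: Grimmett2006, §1.4 eq. (1.20) (p. 15)] -/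
theorem rcWeightW_eq_weight_mul_pow (w : Sym2 V → unitInterval) (q : ℝ) (ω : BondConfig V) :
    rcWeightW w q ∅ ω = weight (fun e => ((w e : unitInterval) : ℝ)) ω * q ^ clusterCount ω ∅ := by
  rw [← crWeight_pow]; rfl

/-- **`(∫_D h dφ_{w,q})·Z_{w,q} = q²·Σ_ω weight_w(ω)·q^{k(ω)−2}·h(ω)·1_D(ω)`** for `D ⊆ {a ↮ c}` and `q > 0`.
[cite: Grimmett2006, §1.4 eq. (1.20) (p. 15); §1.2 eq. (1.1) (p. 4)] -/
theorem setIntegral_mul_Z_eq_sq_mul (w : Sym2 V → unitInterval) {q : ℝ} (hq : 0 < q) (h : BondConfig V → ℝ) {D : Set (BondConfig V)}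
    {a c : V} (hD : D ⊆ sepEv a c) :
    (∫ ω in D, h ω ∂(rcMeasureW w q ∅)) * rcPartitionFunctionW w q ∅ =
      q ^ 2 * ∑ ω : BondConfig V, weight (fun e => ((w e : unitInterval) : ℝ)) ω * q ^ (clusterCount ω ∅ - 2) * (h ω * ind D ω) := by
  have hZ := rcPartitionFunctionW_pos w hq ∅
  rw [setIntegral_rcMeasureW_eq_sum w hq, Finset.sum_mul, Finset.mul_sum]
  refine Finset.sum_congr rfl fun ω _ => ?_
  by_cases hω : ω ∈ D
  · have hk : 2 ≤ clusterCount ω ∅ := two_le_clusterCount_of_not_reachable ((mem_sepEv_iff _ _ _).1 (hD hω))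
    have hmass : rcMass w q ω * rcPartitionFunctionW w q ∅ = rcWeightW w q ∅ ω := by
      unfold rcMass; rw [div_mul_cancel₀ _ hZ.ne']
    calc rcMass w q ω * (h ω * ind D ω) * rcPartitionFunctionW w q ∅
        = rcWeightW w q ∅ ω * (h ω * ind D ω) := by rw [← hmass]; ring
      _ = weight (fun e => ((w e : unitInterval) : ℝ)) ω * (q ^ 2 * q ^ (clusterCount ω ∅ - 2)) * (h ω * ind D ω) := by
          rw [rcWeightW_eq_weight_mul_pow, ← pow_add, Nat.add_sub_cancel' hk]
      _ = _ := by ring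
  · rw [ind_of_not_mem hω]; ring

/-- **At `q = 0` the level mass is the product-measure integral over the level-two slice**:
`Σ_ω weight_w(ω)·0^{k(ω)−2}·h(ω)·1_D(ω) = ∫_{D ∩ L₂} h dP_w` (`D ⊆ {a ↮ c}`). [cite: Grimmett2006, §1.2 eq. (1.1) (p. 4)] -/
theorem levelMass_zero (w : Sym2 V → unitInterval) (h : BondConfig V → ℝ) {D : Set (BondConfig V)} {a c : V} (hD : D ⊆ sepEv a c) :
    ∑ ω : BondConfig V, weight (fun e => ((w e : unitInterval) : ℝ)) ω * (0 : ℝ) ^ (clusterCount ω ∅ - 2) * (h ω * ind D ω) =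
      ∫ ω in D ∩ levelSet V 2, h ω ∂(prodBernoulli w) := by
  rw [← integral_indicator (MeasurableSet.of_discrete), integral_prodBernoulli_eq_sum]
  refine Finset.sum_congr rfl fun ω _ => ?_
  by_cases hω : ω ∈ D
  · have hk : 2 ≤ clusterCount ω ∅ := two_le_clusterCount_of_not_reachable ((mem_sepEv_iff _ _ _).1 (hD hω))
    by_cases h2 : clusterCount ω ∅ = 2
    · rw [h2, Nat.sub_self, pow_zero, mul_one, ind_of_mem hω, mul_one,
        indicator_of_mem (show ω ∈ D ∩ levelSet V 2 from ⟨hω, h2⟩)]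
    · rw [zero_pow (by omega), mul_zero, zero_mul, indicator_of_notMem (fun h' : ω ∈ D ∩ levelSet V 2 => h2 h'.2), mul_zero]
  · rw [ind_of_not_mem hω, mul_zero, mul_zero, indicator_of_notMem (fun h' : ω ∈ D ∩ levelSet V 2 => hω h'.1), mul_zero]

/-! ### The arrow -/

/-- **vdBHK Thm. 1.4 for every `φ_{w,q}`, `0 < q < 1`, at one vertex type ⇒ the level-two master node there** (`q → 0⁺`).
[cite: VandenbergHaggstromKahn2005, Thm. 1.4 (p. 7)] [cite: Grimmett2006, §1.4 eq. (1.20) (p. 15); §3.9 (pp. 63–65)] -/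
theorem twoClusterCrossNegAssocOn_of_forall_fkCrossNegAssocOn (h : ∀ q : ℝ, 0 < q → q < 1 → FKCrossNegAssocOn V q) :
    TwoClusterCrossNegAssocOn V := by
  intro w a c F G hF hG
  set D : Set (BondConfig V) := sepEv a c with hDdef
  have hD : D ⊆ sepEv a c := subset_rfl
  -- the four level masses, as polynomials in `q`
  set wt : BondConfig V → ℝ := fun ω => weight (fun e => ((w e : unitInterval) : ℝ)) ω with hwt
  set fFG : BondConfig V → ℝ := fun ω => F (openEdgeCluster ω a) * G (openEdgeCluster ω c) with hfFG
  set fF : BondConfig V → ℝ := fun ω => F (openEdgeCluster ω a) with hfF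
  set fG : BondConfig V → ℝ := fun ω => G (openEdgeCluster ω c) with hfG
  set M : (BondConfig V → ℝ) → ℝ → ℝ := fun hh q => ∑ ω : BondConfig V, wt ω * q ^ (clusterCount ω ∅ - 2) * (hh ω * ind D ω) with hM
  have hcont : ∀ hh, Continuous (M hh) := fun hh => by
    simp only [hM]
    exact continuous_finsetSum _ fun ω _ => (continuous_const.mul (continuous_pow _)).mul continuous_const
  -- the inequality between the masses for every `0 < q < 1`
  set Φ : ℝ → ℝ := fun q => M fF q * M fG q - M (fun _ => 1) q * M fFG q with hΦ
  have hΦq : ∀ q : ℝ, 0 < q → q < 1 → 0 ≤ Φ q := by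
    intro q hq hq1
    have hZ := rcPartitionFunctionW_pos w hq ∅
    have key := h q hq hq1 w a c F G hF hG
    -- `φ(D) = ∫_D 1 dφ`
    have hreal : (rcMeasureW w q ∅).real D = ∫ ω in D, (fun _ => (1 : ℝ)) ω ∂(rcMeasureW w q ∅) := by
      rw [setIntegral_const, smul_eq_mul, mul_one]
    rw [hreal] at key
    have key' := mul_le_mul_of_nonneg_right key (mul_nonneg hZ.le hZ.le)
    have e1 := setIntegral_mul_Z_eq_sq_mul w hq (fun _ => (1 : ℝ)) hD
    have e2 := setIntegral_mul_Z_eq_sq_mul w hq fFG hD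
    have e3 := setIntegral_mul_Z_eq_sq_mul w hq fF hD
    have e4 := setIntegral_mul_Z_eq_sq_mul w hq fG hD
    have lhs : (∫ ω in D, (fun _ => (1 : ℝ)) ω ∂(rcMeasureW w q ∅)) * (∫ ω in D, fFG ω ∂(rcMeasureW w q ∅)) *
        (rcPartitionFunctionW w q ∅ * rcPartitionFunctionW w q ∅) = q ^ 2 * M (fun _ => 1) q * (q ^ 2 * M fFG q) := by
      rw [← e1, ← e2]; ring
    have rhs : (∫ ω in D, fF ω ∂(rcMeasureW w q ∅)) * (∫ ω in D, fG ω ∂(rcMeasureW w q ∅)) *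
        (rcPartitionFunctionW w q ∅ * rcPartitionFunctionW w q ∅) = q ^ 2 * M fF q * (q ^ 2 * M fG q) := by
      rw [← e3, ← e4]; ring
    have hq4 : 0 < q ^ 2 * q ^ 2 := by positivity
    have : q ^ 2 * q ^ 2 * (M (fun _ => 1) q * M fFG q) ≤ q ^ 2 * q ^ 2 * (M fF q * M fG q) := by
      have := key'
      simp only [hfFG, hfF, hfG] at this lhs rhs
      nlinarith [this, lhs, rhs]
    have := le_of_mul_le_mul_left this hq4
    simp only [hΦ]; linarith
  -- continuity at `0` along `q = 1/(n+2)`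
  have hcontΦ : Continuous Φ := by
    simp only [hΦ]
    exact ((hcont fF).mul (hcont fG)).sub ((hcont _).mul (hcont fFG))
  have hseq : Tendsto (fun n : ℕ => (1 : ℝ) / ((n : ℝ) + 2)) atTop (𝓝 0) := by
    have h1 : Tendsto (fun n : ℕ => (1 : ℝ) / (((n + 1 : ℕ) : ℝ) + 1)) atTop (𝓝 0) :=
      (tendsto_one_div_add_atTop_nhds_zero_nat).comp (tendsto_add_atTop_nat 1)
    refine h1.congr fun n => ?_
    push_cast; ring_nf
  have hlim : Tendsto (fun n : ℕ => Φ (1 / ((n : ℝ) + 2))) atTop (𝓝 (Φ 0)) := (hcontΦ.tendsto 0).comp hseq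
  have hΦ0 : 0 ≤ Φ 0 := ge_of_tendsto' hlim fun n => hΦq _ (by positivity) (by
    rw [div_lt_one (by positivity)]; linarith [(Nat.cast_nonneg n : (0 : ℝ) ≤ n)])
  -- read off the level-two inequality
  have m1 : M (fun _ => 1) 0 = (prodBernoulli w).real (twoClusterEv a c) := by
    simp only [hM, hwt]
    rw [levelMass_zero w (fun _ => (1 : ℝ)) hD, setIntegral_const, smul_eq_mul, mul_one]; rfl
  have m2 : M fFG 0 = ∫ ω in twoClusterEv a c, F (openEdgeCluster ω a) * G (openEdgeCluster ω c) ∂(prodBernoulli w) := by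
    simp only [hM, hwt]; rw [levelMass_zero w fFG hD]; rfl
  have m3 : M fF 0 = ∫ ω in twoClusterEv a c, F (openEdgeCluster ω a) ∂(prodBernoulli w) := by
    simp only [hM, hwt]; rw [levelMass_zero w fF hD]; rfl
  have m4 : M fG 0 = ∫ ω in twoClusterEv a c, G (openEdgeCluster ω c) ∂(prodBernoulli w) := by
    simp only [hM, hwt]; rw [levelMass_zero w fG hD]; rfl
  simp only [hΦ, m1, m2, m3, m4] at hΦ0
  linarith

/-- **`FKCrossNegAssocPos → TwoClusterCrossNegAssocPos`**: the level-two master node (hence CA₂, FP2, EDOM, OSNC) is a necessary condition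
of vdBHK's Theorem 1.4 for the random-cluster measures with `0 < q < 1`. [cite: VandenbergHaggstromKahn2005, Thm. 1.4 (p. 7)]
[cite: Grimmett2006, §3.9 (pp. 63–65)] -/
theorem twoClusterCrossNegAssocPos_of_fkCrossNegAssocPos (h : FKCrossNegAssocPos) : TwoClusterCrossNegAssocPos :=
  fun n => twoClusterCrossNegAssocOn_of_forall_fkCrossNegAssocOn fun q hq _ => h q hq n

/-- **`FKCrossNegAssocPos → TwoClusterAssocPos`** (positive association of the two-cluster law from vdBHK 1.4 for `φ_{w,q}`, `q < 1`).
[cite: VandenbergHaggstromKahn2005, Thm. 1.4, 1.5 (p. 7)] [cite: Grimmett2006, §3.9 (pp. 63–65)] -/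
theorem twoClusterAssocPos_of_fkCrossNegAssocPos (h : FKCrossNegAssocPos) : TwoClusterAssocPos :=
  twoClusterAssocPos_of_crossNegAssocPos (twoClusterCrossNegAssocPos_of_fkCrossNegAssocPos h)

/-- **`FKCrossNegAssocPos → TwoClusterFourPointPos`** (the two-cluster four-point inequality from vdBHK 1.4 for `φ_{w,q}`, `q < 1`).
[cite: KozmaNitzan2024, Thm. 1, eq. (6) (pp. 7–8)] [cite: VandenbergHaggstromKahn2005, eq. (2) (p. 2)] -/
theorem twoClusterFourPointPos_of_fkCrossNegAssocPos (h : FKCrossNegAssocPos) : TwoClusterFourPointPos :=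
  twoClusterFourPointPos_of_crossNegAssocPos (twoClusterCrossNegAssocPos_of_fkCrossNegAssocPos h)

end FK

end Summit.CriticalPhenomena.PercolationContinuityZ3.Theorems

end
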